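import Summits.Ventures.DiscreteObjects.Hadamard.QuaternaryQR167
import Summits.Ventures.DiscreteObjects.Hadamard.Order167Normalizer668

/-!
# Hadamard 668 census — row F7 (quaternary two-circulant `CH(334)`): phase/swap-twisted affine symmetries of a quaternary
# complementary pair over `ZMod 167` have multiplier `±1` (kernel EXCLUSION of every other symmetry type)

Framing: lottery ticket; floor = certified bounds/negative ranges.

Cell pub-namedobj (venture DiscreteObjects), target (H), hadamard gen 26.  Row F7 of the census: two quaternary (`±1, ±i`) sequences
`a, b` on `ZMod 167` with `CPAF_a(s) + CPAF_b(s) = 0` for `s ≠ 0` give a two-circulant complex Hadamard matrix `CH(334)` and, by Turyn's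
doubling, `H(668)`.  Gen 2/4 certified (`no_quaternary_pair_qr167`, 0 of 4096) that no such pair has both rows invariant under the
squares `C₈₃ = ⟨4⟩`.  The natural symmetry group of the system is larger: independent translations of the two rows, a common multiplier,
the swap `a ↔ b`, and unit PHASES `x ↦ εx`, `ε ∈ {±1, ±i}`.  A symmetry is a relation `x_{π k}(h t + c_k) = ε_k x_k(t)` (`π ∈ S₂`,
`ε_k ∈ {±1, ±i}`, `c_k ∈ ZMod 167`, `h ∈ ZMod 167`).  This file is the F7 analogue of `AffineSymmetryGSQuad668`:
* `phaseSymmetry_iterate2`, `phaseRow_iterate4`, `rowAffineInvariant_of_phaseSymmetry` — `π² = 1` and `ε⁴ = 1` make each row invariant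
  under its own affine map `t ↦ h⁸ t + D_k`;
* `cpaf_translate`, `cpaf_one_of_constant`, `recentre_of_affineInvariant` — Hermitian PAF is translation invariant; a constant
  quaternary row has `CPAF(1) = 167`; an affine-invariant row (`t ↦ g t + D`, `g ≠ 1`) has a `g`-invariant translate;
* **`quatPair167_affineSymmetry_sq_eq_one`** (EXCLUSION) — such a symmetry forces **`h² = 1`**: `h = 0` makes both rows constant
  (`CPAF = 167 + 167 ≠ 0`); for `h ≠ 0`, `h² ≠ 1`, `g = h⁸` has `g² ≠ 1` (`gcd(16,166) = 2`), the recentred rows are `g`-invariant, hence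
  square-invariant (`inv4_of_hInvariant`), contradicting `no_quaternary_pair_qr167`;
* `quatPair167_no_twistedMultiplier` — in particular no phase/swap/shift-twisted multiplier of order `83` or `166`.
So a CH(334) search over `ZMod 167` gains nothing from any multiplier assumption of order `> 2`, however twisted.  (Complex conjugation
and reversal symmetries are not treated here.)  EXCLUSION of symmetry types of a hypothetical object; no Hadamard order excluded; H(668)
untouched; HITS 0/4.  Ours, elementary given the cited tree lemmas; no `sorry`; `decide` only on the four quaternary units and on `S₂`.
-/

open Finset BigOperators

namespace Summit.Ventures.DiscreteObjects.Hadamard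

/-! ## §1 Small facts about the quaternary units -/

/-- the quaternary units are closed under multiplication. -/
lemma quatUnits_mul_mem : ∀ u ∈ quatUnits, ∀ v ∈ quatUnits, u * v ∈ quatUnits := by decide

/-- every quaternary unit has `ε⁴ = 1`. -/
lemma quatUnits_pow_four : ∀ u ∈ quatUnits, u ^ 4 = 1 := by decide

/-- every quaternary unit has norm one: `u · ū = 1`. -/
lemma quatUnits_mul_star : ∀ u ∈ quatUnits, u * star u = 1 := by decide

/-- `1` is a quaternary unit. -/
lemma one_mem_quatUnits : (1 : GaussianInt) ∈ quatUnits := by decide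

/-- permutations of two letters square to the identity. -/
lemma perm_fin2_sq (π : Equiv.Perm (Fin 2)) : π ^ 2 = 1 := by
  have h : ∀ τ : Equiv.Perm (Fin 2), τ ^ 2 = 1 := by decide
  exact h π

/-! ## §2 Iterating a phase/swap-twisted affine symmetry -/

section Iterate

variable {n : ℕ} {x : Fin 2 → ZMod n → GaussianInt} {h : ZMod n} {c : Fin 2 → ZMod n} {π : Equiv.Perm (Fin 2)}
  {ε : Fin 2 → GaussianInt}

/-- two steps of `x (π k) (h t + c_k) = ε_k x_k(t)`: since `π² = 1`, each row satisfies `x_k(h² t + C_k) = η_k x_k(t)` with a quaternary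
unit `η_k = ε_{π k} ε_k`. -/
lemma phaseSymmetry_iterate2 (hε : ∀ k, ε k ∈ quatUnits) (hrel : ∀ k t, x (π k) (h * t + c k) = ε k * x k t) :
    ∃ (η : Fin 2 → GaussianInt) (C : Fin 2 → ZMod n), (∀ k, η k ∈ quatUnits) ∧ ∀ k t, x k (h ^ 2 * t + C k) = η k * x k t := by
  refine ⟨fun k => ε (π k) * ε k, fun k => h * c k + c (π k), fun k => quatUnits_mul_mem _ (hε _) _ (hε _), fun k t => ?_⟩
  have hππ : π (π k) = k := by
    have e := perm_fin2_sq π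
    rw [sq, Equiv.ext_iff] at e
    exact e k
  have e1 := hrel (π k) (h * t + c k)
  rw [hππ, hrel k t] at e1
  rw [show h ^ 2 * t + (h * c k + c (π k)) = h * (h * t + c k) + c (π k) by ring, e1, mul_assoc]

/-- four steps of a single-row relation `f (g t + d) = η f(t)`: `f (g⁴ t + d') = η⁴ f(t)`. -/
lemma phaseRow_iterate4 {f : ZMod n → GaussianInt} {g d : ZMod n} {η : GaussianInt} (hrel : ∀ t, f (g * t + d) = η * f t) :
    ∀ t, f (g ^ 4 * t + (g ^ 3 + g ^ 2 + g + 1) * d) = η ^ 4 * f t := by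
  intro t
  have step : ∀ u, f (g * u + d) = η * f u := hrel
  have e1 := step t
  have e2 := step (g * t + d)
  have e3 := step (g * (g * t + d) + d)
  have e4 := step (g * (g * (g * t + d) + d) + d)
  rw [show g ^ 4 * t + (g ^ 3 + g ^ 2 + g + 1) * d = g * (g * (g * (g * t + d) + d) + d) + d by ring, e4, e3, e2, e1]
  ring

/-- **each row is invariant under its own affine map `t ↦ h⁸ t + D_k`.** -/
theorem rowAffineInvariant_of_phaseSymmetry (hε : ∀ k, ε k ∈ quatUnits) (hrel : ∀ k t, x (π k) (h * t + c k) = ε k * x k t) :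
    ∃ D : Fin 2 → ZMod n, ∀ k t, x k (h ^ 8 * t + D k) = x k t := by
  obtain ⟨η, C, hη, h2⟩ := phaseSymmetry_iterate2 hε hrel
  refine ⟨fun k => ((h ^ 2) ^ 3 + (h ^ 2) ^ 2 + h ^ 2 + 1) * C k, fun k t => ?_⟩
  have e := phaseRow_iterate4 (f := x k) (g := h ^ 2) (d := C k) (η := η k) (h2 k) t
  rw [quatUnits_pow_four _ (hη k), one_mul, ← pow_mul] at e
  exact e

end Iterate

/-! ## §3 Hermitian autocorrelation: translation invariance; constant rows; recentring -/

/-- the Hermitian periodic autocorrelation is invariant under translation of the sequence. -/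
lemma cpaf_translate (x : ZMod 167 → GaussianInt) (μ s : ZMod 167) : CPAF (fun j => x (j + μ)) s = CPAF x s := by
  unfold CPAF
  rw [← Equiv.sum_comp (Equiv.addRight μ) (fun j => x (j + s) * star (x j))]
  refine Finset.sum_congr rfl fun j _ => ?_
  simp only [Equiv.coe_addRight]
  rw [add_right_comm]

/-- a translated quaternary sequence is quaternary. -/
lemma isQuat_translate {x : ZMod 167 → GaussianInt} (hx : IsQuat x) (μ : ZMod 167) : IsQuat fun j => x (j + μ) :=
  fun j => hx (j + μ)

/-- a constant quaternary row has `CPAF(1) = 167`. -/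
lemma cpaf_one_of_constant {x : ZMod 167 → GaussianInt} (hx : IsQuat x) (hconst : ∀ t, x t = x 0) : CPAF x 1 = 167 := by
  unfold CPAF
  rw [Finset.sum_congr rfl fun j _ => by rw [hconst (j + 1), hconst j], Finset.sum_const, Finset.card_univ, ZMod.card,
    quatUnits_mul_star _ (hx 0)]
  simp

/-- recentring: a row invariant under `t ↦ g t + D` with `g ≠ 1` has a `g`-invariant translate (`167` is prime). -/
lemma recentre_of_affineInvariant {f : ZMod 167 → GaussianInt} {g D : ZMod 167} (hg : g ≠ 1)
    (hinv : ∀ t, f (g * t + D) = f t) : ∃ μ : ZMod 167, ∀ t, f (g * t + μ) = f (t + μ) := by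
  haveI : Fact (Nat.Prime 167) := ⟨by norm_num⟩
  have h1 : (1 - g : ZMod 167) ≠ 0 := sub_ne_zero.mpr (Ne.symm hg)
  refine ⟨D * (1 - g)⁻¹, fun t => ?_⟩
  have hfix : g * (D * (1 - g)⁻¹) + D = D * (1 - g)⁻¹ := by
    have e : D * (1 - g)⁻¹ * (1 - g) = D := by rw [mul_assoc, inv_mul_cancel₀ h1, mul_one]
    linear_combination (-1 : ZMod 167) * e
  have e := hinv (t + D * (1 - g)⁻¹)
  rw [show g * (t + D * (1 - g)⁻¹) + D = g * t + (g * (D * (1 - g)⁻¹) + D) by ring, hfix] at e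
  exact e

/-! ## §4 The exclusion -/

/-- **EXCLUSION (row F7).**  Let `x_0, x_1` be quaternary sequences on `ZMod 167` with `CPAF_{x_0}(s) + CPAF_{x_1}(s) = 0` for `s ≠ 0`
(a two-circulant `CH(334)`), and suppose `x_{π k}(h t + c_k) = ε_k x_k(t)` for all `k, t` with `π ∈ S₂`, phases `ε_k ∈ {±1, ±i}`,
row-wise shifts `c_k` and any `h ∈ ZMod 167`.  Then `h² = 1`. -/
theorem quatPair167_affineSymmetry_sq_eq_one (x : Fin 2 → ZMod 167 → GaussianInt) (hq : ∀ k, IsQuat (x k))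
    (hC : ∀ s : ZMod 167, s ≠ 0 → CPAF (x 0) s + CPAF (x 1) s = 0) {h : ZMod 167} {c : Fin 2 → ZMod 167}
    {π : Equiv.Perm (Fin 2)} {ε : Fin 2 → GaussianInt} (hε : ∀ k, ε k ∈ quatUnits)
    (hrel : ∀ k t, x (π k) (h * t + c k) = ε k * x k t) : h ^ 2 = 1 := by
  haveI : Fact (Nat.Prime 167) := ⟨by norm_num⟩
  by_contra hsq
  obtain ⟨D, hD⟩ := rowAffineInvariant_of_phaseSymmetry hε hrel
  by_cases h0 : h = 0
  · -- both rows constant: `CPAF(1) = 167 + 167`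
    subst h0
    have hconst : ∀ k t, x k t = x k 0 := fun k t => by
      have e1 := hD k t
      have e2 := hD k 0
      rw [zero_pow (by norm_num), zero_mul, zero_add] at e1 e2
      rw [← e1, e2]
    have e := hC 1 one_ne_zero
    rw [cpaf_one_of_constant (hq 0) (hconst 0), cpaf_one_of_constant (hq 1) (hconst 1)] at e
    norm_num at e
  · set g : ZMod 167 := h ^ 8 with hg
    have hF : h ^ 166 = 1 := by simpa using ZMod.pow_card_sub_one_eq_one h0
    have hg2 : g ^ 2 ≠ 1 := by
      intro h16
      rw [hg, ← pow_mul, show 8 * 2 = 16 by norm_num] at h16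
      have h2 : h ^ Nat.gcd 16 166 = 1 := pow_gcd_eq_one.2 ⟨h16, hF⟩
      rw [show Nat.gcd 16 166 = 2 by decide] at h2
      exact hsq h2
    have hg1 : g ≠ 1 := fun h1 => hg2 (by rw [h1, one_pow])
    have hg0 : g ≠ 0 := by rw [hg]; exact pow_ne_zero _ h0
    set u : (ZMod 167)ˣ := Units.mk0 g hg0 with hu
    have hug : (u : ZMod 167) = g := rfl
    have husq : (u : ZMod 167) ^ 2 ≠ 1 := by rwa [hug]
    -- recentre each row and conclude square-invariance
    have hrow : ∀ k, ∃ μ : ZMod 167, ∀ i, (fun j => x k (j + μ)) (4 * i) = (fun j => x k (j + μ)) i := by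
      intro k
      obtain ⟨μ, hμ⟩ := recentre_of_affineInvariant (f := x k) hg1 (hD k)
      refine ⟨μ, inv4_of_hInvariant (fun j => x k (j + μ)) u husq fun i => ?_⟩
      show x k ((u : ZMod 167) * i + μ) = x k (i + μ)
      rw [hug]
      exact hμ i
    choose μ hμ using hrow
    refine no_quaternary_pair_qr167 (fun j => x 0 (j + μ 0)) (fun j => x 1 (j + μ 1)) (isQuat_translate (hq 0) _)
      (isQuat_translate (hq 1) _) (hμ 0) (hμ 1) fun s hs => ?_
    rw [cpaf_translate, cpaf_translate]
    exact hC s hs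

/-- equivalently: the multiplier part is `1` or `-1`. -/
theorem quatPair167_affineSymmetry_eq_one_or_eq_neg_one (x : Fin 2 → ZMod 167 → GaussianInt) (hq : ∀ k, IsQuat (x k))
    (hC : ∀ s : ZMod 167, s ≠ 0 → CPAF (x 0) s + CPAF (x 1) s = 0) {h : ZMod 167} {c : Fin 2 → ZMod 167}
    {π : Equiv.Perm (Fin 2)} {ε : Fin 2 → GaussianInt} (hε : ∀ k, ε k ∈ quatUnits)
    (hrel : ∀ k t, x (π k) (h * t + c k) = ε k * x k t) : h = 1 ∨ h = -1 := by
  haveI : Fact (Nat.Prime 167) := ⟨by norm_num⟩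
  exact mul_self_eq_one_iff.mp (by rw [← sq]; exact quatPair167_affineSymmetry_sq_eq_one x hq hC hε hrel)

/-- **negative line: no phase/swap/shift-twisted multiplier of order `83` or `166` (indeed none with `h ∉ {1, -1}`) for a quaternary
two-circulant `CH(334)` over `ZMod 167`.** -/
theorem quatPair167_no_twistedMultiplier {h : ZMod 167} (h1 : h ≠ 1) (hm1 : h ≠ -1) (c : Fin 2 → ZMod 167)
    (π : Equiv.Perm (Fin 2)) (ε : Fin 2 → GaussianInt) (hε : ∀ k, ε k ∈ quatUnits) :
    ¬ ∃ x : Fin 2 → ZMod 167 → GaussianInt, (∀ k, IsQuat (x k)) ∧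
      (∀ s : ZMod 167, s ≠ 0 → CPAF (x 0) s + CPAF (x 1) s = 0) ∧ ∀ k t, x (π k) (h * t + c k) = ε k * x k t :=
  fun ⟨x, hq, hC, hrel⟩ => by
    rcases quatPair167_affineSymmetry_eq_one_or_eq_neg_one x hq hC hε hrel with e | e
    · exact h1 e
    · exact hm1 e

/-- the two-row form (rows `a, b`; the symmetry maps row `k` to row `π k`).
lottery ticket; floor = certified bounds/negative ranges. -/
theorem no_quaternary_pair_twistedAffine167 (a b : ZMod 167 → GaussianInt) (ha : IsQuat a) (hb : IsQuat b)
    (hC : ∀ s : ZMod 167, s ≠ 0 → CPAF a s + CPAF b s = 0) {h : ZMod 167} (hsq : h ^ 2 ≠ 1) (sh : Fin 2 → ZMod 167)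
    (π : Equiv.Perm (Fin 2)) (ε : Fin 2 → GaussianInt) (hε : ∀ k, ε k ∈ quatUnits)
    (hrel : ∀ k t, (![a, b] (π k)) (h * t + sh k) = ε k * (![a, b] k) t) : False :=
  hsq (quatPair167_affineSymmetry_sq_eq_one ![a, b] (fun k => by fin_cases k <;> assumption) hC hε hrel)

end Summit.Ventures.DiscreteObjects.Hadamard
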